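import Summits.CriticalPhenomena.PercolationContinuityZ3.Theorems.PercLowPointHalfSpaceBoundaryTwoArmDecayStubStepCount
import Summits.CriticalPhenomena.PercolationContinuityZ3.Theorems.PercLowPointHalfSpaceBoundaryTwoArmDecayStubStepSums

/-!
# Stub `stub_step` of crux `BoundaryTwoArmDecay` (stmt-CriticalPhenomena-0911): ONE ROUND of the bootstrap

Proves EXACTLY the registered stub `stub_step` of the crux skeleton
`Cruxes/BoundaryTwoArmDecay/Lines/staircase_bootstrap_floor_decoupling.lean` (line
`staircase-bootstrap-floor-decoupling`, crux `PercLowPointHalfSpace.BoundaryTwoArmDecay`):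

  `Census → TallDensity → Q (floor decoupling) → Q_conf (confinement) → ∀ a ≥ 0, AprioriV a → ∀ σ > 0,
   AprioriV (3 - σ - max 0 (2 - a))`,

all four inputs being HYPOTHESES (pure implication), with `A_n = kissV n 0 1` (`…StubStepSymm`).
Lands with `--supports stmt-CriticalPhenomena-0911`.

Proof (parts 1–3 are the helper files `…StubStepSymm`, `…StubStepSums`, `…StubStepCount`):
(S1) floor symmetries `P(kissV m x j) = P(kissV m 0 1)`; (S2) on `A_n ∩ conf n` the number `K_n` of
partner-kiss edges is at most `2N`, `N = 2 #F_small + Σ_{dyadic far roots} 1{kissV (2^k) x j}`; (S3) the split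
`P(A_n ∩ conf) ≤ P(A_n ∩ {K_n ≤ k}) + P(A_n ∩ {k < 2N})` and Markov for `N`; (S4) PRICING of the far roots by
Q, (S1) and the a-priori bound: `(k+1) P(A_n ∩ {k < 2N}) ≤ P(A_n) S(n)` with
`S(n) ≤ C_S n^{max 0 (2-a) + δ}` (`sum_price_le`, `weightSum_le`, this file); (S5) ABSORPTION with `Q_conf`
at loss `s` and `k = ⌈2 n^s S(n)⌉ + 1`: `P(A_n) ≤ C₂ n^{2s + max 0 (2-a) + δ} e_n` for `n ≥ N₀`
(`StubStep.absorb`); (S6) DYADIC AVERAGING: `A_n` is antitone and `Σ_{m ∈ [N,2N]} e_m ≤ ν_N ≤ C_t N^{t-2}`,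
whence `P(A_{2N}) ≤ C₃ N^{-(3 - σ - max 0 (2-a))}` (`s = δ = t = σ/4`) and the bound for every `n ≥ 1`
(`StubStep.even_bound`, `StubStep.decay_of_eventually`).
-/

noncomputable section

namespace Summit.CriticalPhenomena.PercolationContinuityZ3.Theorems.BoundaryTwoArmDecay

open MeasureTheory
open scoped ENNReal Classical
open Literature.Probability.Percolation Literature.Probability.LatticeModels

namespace StubStep

open Negative (μ)

/-! ### The level densities (skeleton bodies) -/

/-- `e_m := E[1{height U = m}/|U ∩ ∂ℍ|]` — exact-height density per floor site (the skeleton's `eDens`). -/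
def exactDens (m : ℕ) : ℝ≥0∞ :=
  ∫⁻ ω, {ω | (∃ y : Site 3, (m : ℤ) ≤ y 0 ∧ ω ∈ openConnIn (halfSpace 3) 0 y) ∧
      ¬ (∃ y : Site 3, ((m + 1 : ℕ) : ℤ) ≤ y 0 ∧ ω ∈ openConnIn (halfSpace 3) 0 y)}.indicator
    (fun ω => (((halfSpaceFootprint ω : ℕ∞) : ENNReal))⁻¹) ω ∂μ

/-- `ν_m := E[1{U meets level m}/|U ∩ ∂ℍ|]` — tall density per floor site (the skeleton's `tallDens`). -/
def tallDens (m : ℕ) : ℝ≥0∞ :=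
  ∫⁻ ω, {ω | ∃ y : Site 3, (m : ℤ) ≤ y 0 ∧ ω ∈ openConnIn (halfSpace 3) 0 y}.indicator
    (fun ω => (((halfSpaceFootprint ω : ℕ∞) : ENNReal))⁻¹) ω ∂μ

/-- The dyadic weight sum `Σ_{⟨k,x,j⟩ ∈ idx} (2^k)^{-a}`. -/
def weightSum (a : ℝ) (d₀ n : ℕ) : ℝ := ∑ t ∈ idx d₀ n, ((2 ^ t.1 : ℕ) : ℝ) ^ (-a)

/-! ### (S6) The densities in real numbers -/

/-- `Σ_{m=N}^{2N} e_m ≤ C_t⁺ N^{t-2}` whenever `ν_N ≤ ofReal (C_t N^{t-2})`. -/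
theorem sum_exactDens_toReal_le {Ct t : ℝ} {N : ℕ}
    (hT : tallDens N ≤ ENNReal.ofReal (Ct * (N : ℝ) ^ (t - 2))) :
    ∑ m ∈ Finset.Icc N (2 * N), (exactDens m).toReal ≤ max Ct 0 * (N : ℝ) ^ (t - 2) := by
  have hb : 0 ≤ max Ct 0 * (N : ℝ) ^ (t - 2) :=
    mul_nonneg (le_max_right _ _) (Real.rpow_nonneg (Nat.cast_nonneg _) _)
  have hT' : tallDens N ≤ ENNReal.ofReal (max Ct 0 * (N : ℝ) ^ (t - 2)) :=
    hT.trans (ENNReal.ofReal_le_ofReal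
      (mul_le_mul_of_nonneg_right (le_max_left _ _) (Real.rpow_nonneg (Nat.cast_nonneg _) _)))
  have hTtop : tallDens N ≠ ∞ := ne_top_of_le_ne_top ENNReal.ofReal_ne_top hT'
  have hsum : ∑ m ∈ Finset.Icc N (2 * N), exactDens m ≤ tallDens N :=
    sum_exactDens_le_tallDens N _ fun m hm => (Finset.mem_Icc.1 hm).1
  have hne : ∀ m ∈ Finset.Icc N (2 * N), exactDens m ≠ ∞ := fun m hm =>
    ne_top_of_le_ne_top hTtop
      ((Finset.single_le_sum (fun _ _ => zero_le) hm).trans hsum)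
  rw [← ENNReal.toReal_sum hne]
  exact ENNReal.toReal_le_of_le_ofReal hb (hsum.trans hT')

/-! ### (S4) Pricing of the far roots -/

/-- **Pricing by Q, symmetry and the a-priori bound.** For `n ≥ 1`:
`Σ_{⟨k,x,j⟩ ∈ idx} P(A_n ∩ kissV (2^k) x j) ≤ P(A_n) · C_Q⁺ C_a⁺ · Σ_{idx} (2^k)^{-a}`. -/
theorem sum_price_le {C_Q C_a a : ℝ} {d₀ n : ℕ} (hn : 1 ≤ n)
    (hQ : ∀ (j : Fin 3) (n m : ℕ) (x : Site 3), j ≠ 0 → x 0 = 0 → d₀ ≤ m → m ≤ n →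
      3 * m ≤ floorSup x →
        μ.real (kissV n 0 1 ∩ kissV m x j) ≤ C_Q * μ.real (kissV n 0 1) * μ.real (kissV m x j))
    (hAp : ∀ m : ℕ, 1 ≤ m → μ.real (kissV m 0 1) ≤ C_a * (m : ℝ) ^ (-a)) :
    ∑ t ∈ idx d₀ n, μ.real (kissV n 0 1 ∩ kissV (2 ^ t.1) t.2.1 t.2.2) ≤
      μ.real (kissV n 0 1) * (max C_Q 0 * max C_a 0 * weightSum a d₀ n) := by
  rw [weightSum, Finset.mul_sum, Finset.mul_sum]
  refine Finset.sum_le_sum fun t ht => ?_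
  obtain ⟨hk, hx, hj⟩ := mem_idx.1 ht
  obtain ⟨hkL, hd₀⟩ := mem_scales.1 hk
  obtain ⟨⟨hx0, -⟩, h3⟩ := mem_grp.1 hx
  have hj0 : t.2.2 ≠ 0 := ne_zero_of_mem_dirs hj
  have hkn : 2 ^ t.1 ≤ n := (Nat.pow_le_pow_right (by norm_num) hkL).trans (Nat.pow_log_le_self 2 (by omega))
  have hP0 : 0 ≤ μ.real (kissV n 0 1) := measureReal_nonneg
  have hK0 : 0 ≤ μ.real (kissV (2 ^ t.1) t.2.1 t.2.2) := measureReal_nonneg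
  have hw0 : 0 ≤ ((2 ^ t.1 : ℕ) : ℝ) ^ (-a) := Real.rpow_nonneg (Nat.cast_nonneg _) _
  calc μ.real (kissV n 0 1 ∩ kissV (2 ^ t.1) t.2.1 t.2.2)
      ≤ C_Q * μ.real (kissV n 0 1) * μ.real (kissV (2 ^ t.1) t.2.1 t.2.2) :=
        hQ t.2.2 n (2 ^ t.1) t.2.1 hj0 hx0 hd₀ hkn h3
    _ ≤ max C_Q 0 * μ.real (kissV n 0 1) * μ.real (kissV (2 ^ t.1) t.2.1 t.2.2) :=
        mul_le_mul_of_nonneg_right (mul_le_mul_of_nonneg_right (le_max_left _ _) hP0) hK0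
    _ = max C_Q 0 * μ.real (kissV n 0 1) * μ.real (kissV (2 ^ t.1) 0 1) := by
        rw [real_kissV_eq hx0 hj0]
    _ ≤ max C_Q 0 * μ.real (kissV n 0 1) * (max C_a 0 * ((2 ^ t.1 : ℕ) : ℝ) ^ (-a)) := by
        refine mul_le_mul_of_nonneg_left ?_ (mul_nonneg (le_max_right _ _) hP0)
        calc μ.real (kissV (2 ^ t.1) 0 1) ≤ C_a * ((2 ^ t.1 : ℕ) : ℝ) ^ (-a) :=
              hAp (2 ^ t.1) Nat.one_le_two_pow
          _ ≤ max C_a 0 * ((2 ^ t.1 : ℕ) : ℝ) ^ (-a) := mul_le_mul_of_nonneg_right (le_max_left _ _) hw0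
    _ = μ.real (kissV n 0 1) * (max C_Q 0 * max C_a 0 * ((2 ^ t.1 : ℕ) : ℝ) ^ (-a)) := by ring

/-- **The dyadic weight sum.** For `n ≥ 1`: `Σ_{⟨k,x,j⟩ ∈ idx} (2^k)^{-a} ≤ 578 (log₂ n + 1) n^{max 0 (2-a)}`
(`#grp k ≤ (16·2^k+1)² ≤ 289 (2^k)²`, two directions, `(2^k)² (2^k)^{-a} ≤ n^{max 0 (2-a)}`). -/
theorem weightSum_le (a : ℝ) (d₀ : ℕ) {n : ℕ} (hn : 1 ≤ n) :
    weightSum a d₀ n ≤ 578 * ((Nat.log 2 n : ℝ) + 1) * (n : ℝ) ^ (max 0 (2 - a)) := by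
  set L := Nat.log 2 n with hL
  set θ := max 0 (2 - a) with hθ
  have hterm : ∀ k ∈ Finset.range (L + 1),
      ((grp k ×ˢ dirs).card : ℝ) * ((2 ^ k : ℕ) : ℝ) ^ (-a) ≤ 578 * (n : ℝ) ^ θ := by
    intro k hk
    have hkL : k ≤ L := Nat.lt_succ_iff.1 (Finset.mem_range.1 hk)
    have hkn : 2 ^ k ≤ n := (Nat.pow_le_pow_right (by norm_num) hkL).trans (Nat.pow_log_le_self 2 (by omega))
    have hcard : ((grp k ×ˢ dirs).card : ℝ) ≤ 578 * ((2 : ℝ) ^ k) ^ 2 := by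
      rw [Finset.card_product, card_dirs]
      have h1 : (grp k).card * 2 ≤ (16 * 2 ^ k + 1) ^ 2 * 2 := Nat.mul_le_mul_right 2 (card_grp_le k)
      have h2 : (16 * 2 ^ k + 1) ^ 2 * 2 ≤ 578 * (2 ^ k) ^ 2 := by
        have := Nat.one_le_two_pow (n := k)
        nlinarith
      exact_mod_cast h1.trans h2
    have hw0 : 0 ≤ ((2 ^ k : ℕ) : ℝ) ^ (-a) := Real.rpow_nonneg (Nat.cast_nonneg _) _
    calc ((grp k ×ˢ dirs).card : ℝ) * ((2 ^ k : ℕ) : ℝ) ^ (-a)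
        ≤ 578 * ((2 : ℝ) ^ k) ^ 2 * ((2 ^ k : ℕ) : ℝ) ^ (-a) := mul_le_mul_of_nonneg_right hcard hw0
      _ = 578 * (((2 : ℝ) ^ k) ^ 2 * ((2 : ℝ) ^ k) ^ (-a)) := by push_cast; ring
      _ ≤ 578 * (n : ℝ) ^ θ := mul_le_mul_of_nonneg_left (pow_weight_le hn hkn) (by norm_num)
  have hsub : scales d₀ n ⊆ Finset.range (L + 1) := Finset.filter_subset _ _
  calc weightSum a d₀ n = ∑ k ∈ scales d₀ n, ((grp k ×ˢ dirs).card : ℝ) * ((2 ^ k : ℕ) : ℝ) ^ (-a) := by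
        rw [weightSum, idx, Finset.sum_sigma]
        refine Finset.sum_congr rfl fun k _ => ?_
        have hc : ∀ p ∈ grp k ×ˢ dirs,
            ((2 ^ (⟨k, p⟩ : (_ : ℕ) × (Site 3 × Fin 3)).1 : ℕ) : ℝ) ^ (-a) = ((2 ^ k : ℕ) : ℝ) ^ (-a) :=
          fun _ _ => rfl
        rw [Finset.sum_congr rfl hc, Finset.sum_const, nsmul_eq_mul]
    _ ≤ ∑ k ∈ Finset.range (L + 1), ((grp k ×ˢ dirs).card : ℝ) * ((2 ^ k : ℕ) : ℝ) ^ (-a) :=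
        Finset.sum_le_sum_of_subset_of_nonneg hsub fun k _ _ =>
          mul_nonneg (Nat.cast_nonneg _) (Real.rpow_nonneg (Nat.cast_nonneg _) _)
    _ ≤ ∑ _k ∈ Finset.range (L + 1), 578 * (n : ℝ) ^ θ := Finset.sum_le_sum hterm
    _ = 578 * ((L : ℝ) + 1) * (n : ℝ) ^ θ := by
        rw [Finset.sum_const, Finset.card_range, nsmul_eq_mul]
        push_cast
        ring

/-- **`S(n)` is subpolynomial times `n^{max 0 (2-a)}`.** With `S(n) = 4 #F_small + 2 C W(n)` (`C ≥ 0`) and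
`0 < δ`: `S(n) ≤ (4 #F_small + 1156 C) (1 + 2/δ) n^{max 0 (2-a) + δ}` for `n ≥ 1`. -/
theorem S_le {a C δ : ℝ} (hC : 0 ≤ C) (hδ : 0 < δ) (F d₀ : ℕ) {n : ℕ} (hn : 1 ≤ n) :
    4 * (F : ℝ) + 2 * C * weightSum a d₀ n ≤
      (4 * (F : ℝ) + 1156 * C) * (1 + 2 / δ) * (n : ℝ) ^ (max 0 (2 - a) + δ) := by
  have hn1 : (1 : ℝ) ≤ n := by exact_mod_cast hn
  have hnpos : (0 : ℝ) < n := by positivity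
  set θ := max 0 (2 - a) with hθ
  have hθ0 : 0 ≤ θ := le_max_left _ _
  have hW := weightSum_le a d₀ hn
  have hlog := natLog_two_le hn hδ
  have hL0 : (0 : ℝ) ≤ (Nat.log 2 n : ℝ) + 1 := by positivity
  have hnθ : (1 : ℝ) ≤ (n : ℝ) ^ θ := Real.one_le_rpow hn1 hθ0
  have hnδ : (1 : ℝ) ≤ (n : ℝ) ^ δ := Real.one_le_rpow hn1 hδ.le
  have hsplit : (n : ℝ) ^ (θ + δ) = (n : ℝ) ^ θ * (n : ℝ) ^ δ := Real.rpow_add hnpos _ _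
  rw [hsplit]
  -- `W ≤ 578 (L+1) n^θ ≤ 578 (1 + 2/δ) n^δ n^θ`
  have hW' : weightSum a d₀ n ≤ 578 * ((1 + 2 / δ) * (n : ℝ) ^ δ) * (n : ℝ) ^ θ :=
    hW.trans (mul_le_mul_of_nonneg_right (mul_le_mul_of_nonneg_left hlog (by norm_num)) (by positivity))
  -- `4 F ≤ 4 F (1 + 2/δ) n^δ n^θ`
  have hδ' : (1 : ℝ) ≤ 1 + 2 / δ := by
    have : 0 ≤ 2 / δ := by positivity
    linarith
  have hprod : (1 : ℝ) ≤ (1 + 2 / δ) * ((n : ℝ) ^ θ * (n : ℝ) ^ δ) :=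
    one_le_mul_of_one_le_of_one_le hδ' (one_le_mul_of_one_le_of_one_le hnθ hnδ)
  have hF0 : (0 : ℝ) ≤ 4 * F := by positivity
  nlinarith [mul_le_mul_of_nonneg_left hprod hF0, mul_le_mul_of_nonneg_left hW' (by positivity : (0 : ℝ) ≤ 2 * C)]

/-- Arithmetic of one round: from `P ≤ 2 C₁⁺ k e x`, `k ≤ 2 x S + 2`, `S ≤ C_S y` (`x, y ≥ 1`, `e, C₁⁺ ≥ 0`)
conclude `P ≤ 4 C₁⁺ (C_S + 1) (x·x·y) e`. -/
theorem step_arith {P k e x y S C₁p C_S : ℝ} (hx : 1 ≤ x) (hy : 1 ≤ y) (he : 0 ≤ e) (hC₁ : 0 ≤ C₁p)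
    (hP : P ≤ 2 * C₁p * k * e * x) (hk : k ≤ 2 * x * S + 2) (hS : S ≤ C_S * y) :
    P ≤ 4 * C₁p * (C_S + 1) * (x * x * y) * e := by
  have hxy : 1 ≤ x * y := one_le_mul_of_one_le_of_one_le hx hy
  have h1 : 2 * x * S ≤ 2 * x * (C_S * y) := mul_le_mul_of_nonneg_left hS (by linarith)
  have hk' : k ≤ 2 * x * y * (C_S + 1) := by linarith
  calc P ≤ 2 * C₁p * k * e * x := hP
    _ ≤ 2 * C₁p * (2 * x * y * (C_S + 1)) * e * x := by gcongr
    _ = 4 * C₁p * (C_S + 1) * (x * x * y) * e := by ring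

/-! ### (S5) One value of `n`: absorption -/

/-- **One round at a fixed `n ≥ 1`.** Under the census (constant `C₁`), Q (constant `C_Q`, scale `d₀`), the
a-priori bound (constant `C_a`, exponent `a`) and confinement AT `n` with loss `s ≥ 0`, for every `δ > 0`:
`P(A_n) ≤ C₂ n^{2s + max 0 (2-a) + δ} e_n` with `C₂ = 4 C₁⁺ (C_S + 1)`,
`C_S = (4 #F_small + 1156 C_Q⁺ C_a⁺)(1 + 2/δ)`. -/
theorem one_round {C₁ C_Q C_a a s δ : ℝ} {d₀ n : ℕ} (hn : 1 ≤ n) (hs : 0 ≤ s) (hδ : 0 < δ)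
    (hC₁ : ∀ k : ℕ, 1 ≤ k → μ.real (kissV n 0 1 ∩ {ω | (partnerKiss n ω).ncard ≤ k}) ≤
      C₁ * (k : ℝ) * (exactDens n).toReal)
    (hQ : ∀ (j : Fin 3) (n m : ℕ) (x : Site 3), j ≠ 0 → x 0 = 0 → d₀ ≤ m → m ≤ n →
      3 * m ≤ floorSup x →
        μ.real (kissV n 0 1 ∩ kissV m x j) ≤ C_Q * μ.real (kissV n 0 1) * μ.real (kissV m x j))
    (hAp : ∀ m : ℕ, 1 ≤ m → μ.real (kissV m 0 1) ≤ C_a * (m : ℝ) ^ (-a))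
    (hconf : (n : ℝ) ^ (-s) * μ.real (kissV n 0 1) ≤ μ.real (kissV n 0 1 ∩ conf n)) :
    μ.real (kissV n 0 1) ≤
      4 * max C₁ 0 * ((4 * ((floorBox (6 * d₀ + 2)).card : ℝ) + 1156 * (max C_Q 0 * max C_a 0)) *
          (1 + 2 / δ) + 1) * (n : ℝ) ^ (s + s + (max 0 (2 - a) + δ)) * (exactDens n).toReal := by
  have hn1 : (1 : ℝ) ≤ n := by exact_mod_cast hn
  have hnpos : (0 : ℝ) < n := by positivity
  -- name the players
  obtain ⟨P, hP⟩ : ∃ P : ℝ, P = μ.real (kissV n 0 1) := ⟨_, rfl⟩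
  obtain ⟨x, hx⟩ : ∃ x : ℝ, x = (n : ℝ) ^ s := ⟨_, rfl⟩
  obtain ⟨e, he⟩ : ∃ e : ℝ, e = (exactDens n).toReal := ⟨_, rfl⟩
  obtain ⟨W, hW⟩ : ∃ W : ℝ, W = weightSum a d₀ n := ⟨_, rfl⟩
  obtain ⟨S, hS⟩ : ∃ S : ℝ,
      S = 4 * ((floorBox (6 * d₀ + 2)).card : ℝ) + 2 * (max C_Q 0 * max C_a 0) * W := ⟨_, rfl⟩
  obtain ⟨k, hk⟩ : ∃ k : ℕ, k = ⌈2 * x * S⌉₊ + 1 := ⟨_, rfl⟩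
  -- signs and sizes
  have hx1 : 1 ≤ x := by rw [hx]; exact Real.one_le_rpow hn1 hs
  have hx0 : 0 < x := by linarith
  have hC0 : 0 ≤ max C_Q 0 * max C_a 0 := mul_nonneg (le_max_right _ _) (le_max_right _ _)
  have hW0 : 0 ≤ W := by
    rw [hW]
    exact Finset.sum_nonneg fun t _ => Real.rpow_nonneg (Nat.cast_nonneg _) _
  have hS0 : 0 ≤ S := by rw [hS]; positivity
  have he0 : 0 ≤ e := by rw [he]; exact ENNReal.toReal_nonneg
  have hP0 : 0 ≤ P := by rw [hP]; exact measureReal_nonneg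
  have hk1 : 1 ≤ k := by omega
  have hkreal : (k : ℝ) = (⌈2 * x * S⌉₊ : ℝ) + 1 := by rw [hk, Nat.cast_add, Nat.cast_one]
  have hkS : 2 * x * S ≤ (k : ℝ) + 1 := by
    have := Nat.le_ceil (2 * x * S)
    rw [hkreal]
    linarith
  have hk_le : (k : ℝ) ≤ 2 * x * S + 2 := by
    have := Nat.ceil_lt_add_one (by positivity : 0 ≤ 2 * x * S)
    rw [hkreal]
    linarith
  -- the inputs of `absorb`
  have hconf' : x⁻¹ * P ≤ μ.real (kissV n 0 1 ∩ conf n) := by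
    rw [Real.rpow_neg hnpos.le, ← hx, ← hP] at hconf
    exact hconf
  have hsplit : μ.real (kissV n 0 1 ∩ conf n) ≤
      μ.real (kissV n 0 1 ∩ {ω | (partnerKiss n ω).ncard ≤ k}) +
        μ.real (kissV n 0 1 ∩ {ω | k < 2 * bigN d₀ n ω}) :=
    (measureReal_mono (inter_conf_subset_union d₀ n k)).trans (measureReal_union_le _ _)
  have hcensus : μ.real (kissV n 0 1 ∩ {ω | (partnerKiss n ω).ncard ≤ k}) ≤ C₁ * (k : ℝ) * e := by
    rw [he]
    exact hC₁ k hk1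
  have hmarkov : ((k : ℝ) + 1) * μ.real (kissV n 0 1 ∩ {ω | k < 2 * bigN d₀ n ω}) ≤ P * S := by
    have hM := markov_bigN d₀ n k
    have hprice := sum_price_le hn hQ hAp
    rw [← hP] at hM hprice
    rw [← hW] at hprice
    rw [hS]
    calc _ ≤ _ := hM
      _ ≤ _ := by linarith
  have habs := absorb hx0 hP0 hS0 (Nat.cast_nonneg k) he0 measureReal_nonneg hconf' hsplit hcensus
    hmarkov hkS
  -- `S ≤ C_S n^{θ + δ}` and the arithmetic
  have hSle := S_le (a := a) hC0 hδ ((floorBox (6 * d₀ + 2)).card) d₀ hn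
  rw [← hW, ← hS] at hSle
  have hy1 : (1 : ℝ) ≤ (n : ℝ) ^ (max 0 (2 - a) + δ) :=
    Real.one_le_rpow hn1 (add_nonneg (le_max_left _ _) hδ.le)
  have hfin := step_arith hx1 hy1 he0 (le_max_right C₁ 0) habs hk_le hSle
  have hpow : x * x * (n : ℝ) ^ (max 0 (2 - a) + δ) = (n : ℝ) ^ (s + s + (max 0 (2 - a) + δ)) := by
    rw [hx, ← Real.rpow_add hnpos, ← Real.rpow_add hnpos]
  rw [hpow, hP, he] at hfin
  exact hfin

/-! ### Assembly: one round of the staircase -/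

/-- **One round of the staircase** (the content of `stub_step`, hypotheses in the local vocabulary). -/
theorem aprioriV_step
    (hCensus : ∃ C : ℝ, ∀ n k : ℕ, 1 ≤ n → 1 ≤ k →
      μ.real (kissV n 0 1 ∩ {ω | (partnerKiss n ω).ncard ≤ k}) ≤ C * (k : ℝ) * (exactDens n).toReal)
    (hTall : ∀ s : ℝ, 0 < s → ∃ C : ℝ, ∀ n : ℕ, 1 ≤ n → tallDens n ≤ ENNReal.ofReal (C * (n : ℝ) ^ (s - 2)))
    (hQ : ∃ C : ℝ, ∃ d₀ : ℕ, ∀ (j : Fin 3) (n m : ℕ) (x : Site 3), j ≠ 0 → x 0 = 0 → d₀ ≤ m → m ≤ n →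
      3 * m ≤ floorSup x →
        μ.real (kissV n 0 1 ∩ kissV m x j) ≤ C * μ.real (kissV n 0 1) * μ.real (kissV m x j))
    (hConf : ∀ s : ℝ, 0 < s → ∀ᶠ n : ℕ in Filter.atTop,
      (n : ℝ) ^ (-s) * μ.real (kissV n 0 1) ≤ μ.real (kissV n 0 1 ∩ conf n))
    {a : ℝ} (_ha : 0 ≤ a) (hAp : ∃ C : ℝ, ∀ n : ℕ, 1 ≤ n → μ.real (kissV n 0 1) ≤ C * (n : ℝ) ^ (-a))
    {σ : ℝ} (hσ : 0 < σ) :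
    ∃ C : ℝ, ∀ n : ℕ, 1 ≤ n → μ.real (kissV n 0 1) ≤ C * (n : ℝ) ^ (-(3 - σ - max 0 (2 - a))) := by
  obtain ⟨C₁, hC₁⟩ := hCensus
  obtain ⟨C_Q, d₀, hQ'⟩ := hQ
  obtain ⟨C_a, hCa⟩ := hAp
  have hσ4 : 0 < σ / 4 := by positivity
  obtain ⟨Ct, hCt⟩ := hTall (σ / 4) hσ4
  obtain ⟨N₀, hN₀⟩ := Filter.eventually_atTop.1 (hConf (σ / 4) hσ4)
  obtain ⟨θ, hθ⟩ : ∃ θ : ℝ, θ = max 0 (2 - a) := ⟨_, rfl⟩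
  rw [← hθ]
  obtain ⟨C₂, hC₂⟩ : ∃ C₂ : ℝ, C₂ = 4 * max C₁ 0 *
      ((4 * ((floorBox (6 * d₀ + 2)).card : ℝ) + 1156 * (max C_Q 0 * max C_a 0)) * (1 + 2 / (σ / 4)) + 1) :=
    ⟨_, rfl⟩
  obtain ⟨γ, hγ⟩ : ∃ γ : ℝ, γ = σ / 4 + σ / 4 + (θ + σ / 4) := ⟨_, rfl⟩
  have hθ0 : 0 ≤ θ := by rw [hθ]; exact le_max_left _ _
  have hγ0 : 0 ≤ γ := by rw [hγ]; positivity
  have hC₂0 : 0 ≤ C₂ := by rw [hC₂]; positivity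
  -- (S5) the bound at every `n ≥ max N₀ 1`
  have hstep : ∀ n : ℕ, max N₀ 1 ≤ n →
      μ.real (kissV n 0 1) ≤ C₂ * (n : ℝ) ^ γ * (exactDens n).toReal := by
    intro n hn
    have hn1 : 1 ≤ n := le_of_max_le_right hn
    rw [hC₂, hγ, hθ]
    exact one_round hn1 hσ4.le hσ4 (fun k hk => hC₁ n k hn1 hk) hQ' hCa (hN₀ n (le_of_max_le_left hn))
  -- (S6) dyadic averaging
  have hanti : ∀ m m' : ℕ, m ≤ m' → μ.real (kissV m' 0 1) ≤ μ.real (kissV m 0 1) :=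
    fun m m' h => measureReal_mono (kissV_antitone_level h 0 1)
  have hsum : ∀ N : ℕ, 1 ≤ N →
      ∑ m ∈ Finset.Icc N (2 * N), (exactDens m).toReal ≤ max Ct 0 * (N : ℝ) ^ (σ / 4 - 2) :=
    fun N hN => sum_exactDens_toReal_le (hCt N hN)
  have heven : ∀ N : ℕ, max N₀ 1 ≤ N →
      μ.real (kissV (2 * N) 0 1) ≤ C₂ * (2 : ℝ) ^ γ * max Ct 0 * (N : ℝ) ^ (-(3 - σ - θ)) := by
    intro N hN
    have hN1 : 1 ≤ N := le_of_max_le_right hN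
    have h := even_bound (f := fun m => μ.real (kissV m 0 1)) (e := fun m => (exactDens m).toReal)
      hγ0 hC₂0 (le_max_right Ct 0) (fun _ => ENNReal.toReal_nonneg) hanti hstep (hsum N hN1) hN hN1
    have hexp : γ + σ / 4 - 3 = -(3 - σ - θ) := by rw [hγ]; ring
    rw [hexp] at h
    exact h
  exact decay_of_eventually (f := fun m => μ.real (kissV m 0 1)) (le_max_right N₀ 1)
    (fun _ => measureReal_le_one) hanti heven

end StubStep

open StubStep in
/-- **Registered stub `stub_step`** of the skeleton `Cruxes/BoundaryTwoArmDecay/Lines/staircase_bootstrap_floor_decoupling.lean`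
— ONE ROUND OF THE STAIRCASE: `Census → TallDensity → Q → Q_conf → ∀ a ≥ 0, AprioriV a → ∀ σ > 0,
AprioriV (3 - σ - max 0 (2 - a))` (Q-pricing of the partner-kiss count on the confined event — a finite dyadic
sum `S(n) ≲ n^{max(0,2-a)} log n` for every `a ≥ 0` —, Markov, the census with `k ≍ n^{s} S(n)`, dyadic
averaging with `A_n` antitone and `Σ_{m ∈ [n,2n]} e_m ≤ ν_n`; floor symmetries).  Proof: `StubStep.aprioriV_step`. -/
theorem stub_step :
    (∃ C : ℝ, ∀ n k : ℕ, 1 ≤ n → 1 ≤ k →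
      (bondPercolation (zdGraph 3) (criticalProbI 3)).real
          ({ω | (∃ y : Site 3, (n : ℤ) ≤ y 0 ∧ ω ∈ openConnIn (halfSpace 3) 0 y) ∧
              (∃ y : Site 3, (n : ℤ) ≤ y 0 ∧ ω ∈ openConnIn (halfSpace 3) ((0 : Site 3) + Pi.single 1 1) y) ∧
              ω ∉ openConnIn (halfSpace 3) 0 ((0 : Site 3) + Pi.single 1 1)} ∩
            {ω | {q : Site 3 × Site 3 | q.1 0 = 0 ∧ q.2 0 = 0 ∧ (zdGraph 3).Adj q.1 q.2 ∧
                ω ∈ openConnIn (halfSpace 3) 0 q.1 ∧ ω ∉ openConnIn (halfSpace 3) 0 q.2 ∧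
                ∃ y : Site 3, (n : ℤ) ≤ y 0 ∧ ω ∈ openConnIn (halfSpace 3) q.2 y}.ncard ≤ k}) ≤
        C * (k : ℝ) *
          (∫⁻ ω, {ω | (∃ y : Site 3, (n : ℤ) ≤ y 0 ∧ ω ∈ openConnIn (halfSpace 3) 0 y) ∧
                ¬ (∃ y : Site 3, ((n + 1 : ℕ) : ℤ) ≤ y 0 ∧ ω ∈ openConnIn (halfSpace 3) 0 y)}.indicator
              (fun ω => (((halfSpaceFootprint ω : ℕ∞) : ENNReal))⁻¹) ω
              ∂(bondPercolation (zdGraph 3) (criticalProbI 3))).toReal) →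
    (∀ s : ℝ, 0 < s → ∃ C : ℝ, ∀ n : ℕ, 1 ≤ n →
      (∫⁻ ω, {ω | ∃ y : Site 3, (n : ℤ) ≤ y 0 ∧ ω ∈ openConnIn (halfSpace 3) 0 y}.indicator
          (fun ω => (((halfSpaceFootprint ω : ℕ∞) : ENNReal))⁻¹) ω
          ∂(bondPercolation (zdGraph 3) (criticalProbI 3))) ≤ ENNReal.ofReal (C * (n : ℝ) ^ (s - 2))) →
    (∃ C : ℝ, ∃ d₀ : ℕ, ∀ (j : Fin 3) (n m : ℕ) (x : Site 3), j ≠ 0 → x 0 = 0 → d₀ ≤ m → m ≤ n →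
      3 * m ≤ max (x 1).natAbs (x 2).natAbs →
        (bondPercolation (zdGraph 3) (criticalProbI 3)).real
            ({ω | (∃ y : Site 3, (n : ℤ) ≤ y 0 ∧ ω ∈ openConnIn (halfSpace 3) 0 y) ∧
                (∃ y : Site 3, (n : ℤ) ≤ y 0 ∧ ω ∈ openConnIn (halfSpace 3) ((0 : Site 3) + Pi.single 1 1) y) ∧
                ω ∉ openConnIn (halfSpace 3) 0 ((0 : Site 3) + Pi.single 1 1)} ∩
              {ω | (∃ y : Site 3, (m : ℤ) ≤ y 0 ∧ ω ∈ openConnIn (halfSpace 3) x y) ∧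
                (∃ y : Site 3, (m : ℤ) ≤ y 0 ∧ ω ∈ openConnIn (halfSpace 3) (x + Pi.single j 1) y) ∧
                ω ∉ openConnIn (halfSpace 3) x (x + Pi.single j 1)}) ≤
          C * (bondPercolation (zdGraph 3) (criticalProbI 3)).real
              {ω | (∃ y : Site 3, (n : ℤ) ≤ y 0 ∧ ω ∈ openConnIn (halfSpace 3) 0 y) ∧
                (∃ y : Site 3, (n : ℤ) ≤ y 0 ∧ ω ∈ openConnIn (halfSpace 3) ((0 : Site 3) + Pi.single 1 1) y) ∧
                ω ∉ openConnIn (halfSpace 3) 0 ((0 : Site 3) + Pi.single 1 1)} *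
            (bondPercolation (zdGraph 3) (criticalProbI 3)).real
              {ω | (∃ y : Site 3, (m : ℤ) ≤ y 0 ∧ ω ∈ openConnIn (halfSpace 3) x y) ∧
                (∃ y : Site 3, (m : ℤ) ≤ y 0 ∧ ω ∈ openConnIn (halfSpace 3) (x + Pi.single j 1) y) ∧
                ω ∉ openConnIn (halfSpace 3) x (x + Pi.single j 1)}) →
    (∀ s : ℝ, 0 < s → ∀ᶠ n : ℕ in Filter.atTop,
      (n : ℝ) ^ (-s) *
          (bondPercolation (zdGraph 3) (criticalProbI 3)).real
            {ω | (∃ y : Site 3, (n : ℤ) ≤ y 0 ∧ ω ∈ openConnIn (halfSpace 3) 0 y) ∧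
              (∃ y : Site 3, (n : ℤ) ≤ y 0 ∧ ω ∈ openConnIn (halfSpace 3) ((0 : Site 3) + Pi.single 1 1) y) ∧
              ω ∉ openConnIn (halfSpace 3) 0 ((0 : Site 3) + Pi.single 1 1)} ≤
        (bondPercolation (zdGraph 3) (criticalProbI 3)).real
          ({ω | (∃ y : Site 3, (n : ℤ) ≤ y 0 ∧ ω ∈ openConnIn (halfSpace 3) 0 y) ∧
              (∃ y : Site 3, (n : ℤ) ≤ y 0 ∧ ω ∈ openConnIn (halfSpace 3) ((0 : Site 3) + Pi.single 1 1) y) ∧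
              ω ∉ openConnIn (halfSpace 3) 0 ((0 : Site 3) + Pi.single 1 1)} ∩
            {ω | ∀ y : Site 3, ω ∈ openConnIn (halfSpace 3) 0 y → ∀ i : Fin 3, |y i| < ((3 * n : ℕ) : ℤ)})) →
    ∀ a : ℝ, 0 ≤ a →
      (∃ C : ℝ, ∀ n : ℕ, 1 ≤ n →
        (bondPercolation (zdGraph 3) (criticalProbI 3)).real
            {ω | (∃ y : Site 3, (n : ℤ) ≤ y 0 ∧ ω ∈ openConnIn (halfSpace 3) 0 y) ∧
              (∃ y : Site 3, (n : ℤ) ≤ y 0 ∧ ω ∈ openConnIn (halfSpace 3) ((0 : Site 3) + Pi.single 1 1) y) ∧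
              ω ∉ openConnIn (halfSpace 3) 0 ((0 : Site 3) + Pi.single 1 1)} ≤ C * (n : ℝ) ^ (-a)) →
      ∀ σ : ℝ, 0 < σ →
        ∃ C : ℝ, ∀ n : ℕ, 1 ≤ n →
          (bondPercolation (zdGraph 3) (criticalProbI 3)).real
              {ω | (∃ y : Site 3, (n : ℤ) ≤ y 0 ∧ ω ∈ openConnIn (halfSpace 3) 0 y) ∧
                (∃ y : Site 3, (n : ℤ) ≤ y 0 ∧ ω ∈ openConnIn (halfSpace 3) ((0 : Site 3) + Pi.single 1 1) y) ∧
                ω ∉ openConnIn (halfSpace 3) 0 ((0 : Site 3) + Pi.single 1 1)} ≤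
            C * (n : ℝ) ^ (-(3 - σ - max 0 (2 - a))) :=
  fun hCensus hTall hQ hConf _a ha hAp _σ hσ => aprioriV_step hCensus hTall hQ hConf ha hAp hσ

end Summit.CriticalPhenomena.PercolationContinuityZ3.Theorems.BoundaryTwoArmDecay

end
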